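import Summits.Ventures.CertifiedManyBodySolver.Downfold.RouterWordScoreLatticeTriple

/-!
# The «SANDWICH» TRIPLE «q₁ ∣ q₁+secs ∣ w» in closed form for the §4.2 score, and its T′-NICKELATE instance
# «1BH ∣ 1BH+UND:MULTIORB ∣ UND:MULTIORB» (VSET v4 M125 Nd₆Ni₅O₁₂; v8 M330 Pr₄Ni₃O₈ / M331 La₄Ni₃O₈)

Venture CertifiedManyBodySolver, cell `pub/hubbard-downfold`, seat hubbard-downfold-score-2 (session g24, 2026-08-31); namespace
`Summit.Ventures.CertifiedManyBodySolver.Downfold.RouterScore` (continues `RouterWordScoreLatticeTriple.lean` p797367 / p799276 and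
`RouterWordScoreRedundantAlternatives.lean` p744404). Everything here is PROVED (no `sorry`, standard axioms); nothing here is physics.

The point of this file is ONE lemma the seat has used three times under three names: a typing of the form «q₁ ∣ q₁+secs ∣ w» — a bare
primary, the SAME primary with secondaries, and any third word — scores every print exactly like «q₁ ∣ w»: the compound middle word is
dominated by the bare one (`outcome_append_redundant`), whatever `secs` and `w` are. The organic LATTICE TRIPLE (p797367 §2,
w = «UND:LATTICE»), the TETRADYMITE TRIPLE (p799276 §4, q₁ = «EPH», secs = [UND:STRUCT], w = «BI») and tonight's T′-NICKELATE TRIPLE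
(w = «UND:MULTIORB»; score-2 block63 2026-08-31T06:57Z for VSET v4 M125 Nd₆Ni₅O₁₂ at HELD stage, lead g41 STARTED l.11437 (d) / ACK
l.11449; the same typing stands on the v8 T′-trilayer controls M330 / M331 since `RouterWordScoreV8PreregLate` p595911 (h)) are instances.

* §1 (any head alphabet) `dominates_head_cons` («q» dominates «q+secs»), `outcome_sandwich` (the triple ≡ the pair «q₁ ∣ w» on every
  print), `outcome_sandwich_singletons` (w = «q₂» a bare non-structural head ⇒ the two-singletons closed form of p797367 §1:
  structural-led ⇒ ABSTAIN(structure) · led by q₁ or q₂ ⇒ AGREE whatever rides · else PARTIAL iff q₁ or q₂ rides, else DISAGREE).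
* §2 the T′-NICKELATE TRIPLE on the router's heads: `nickelateTriple`, `score_nickelateTriple_eq_pair`, `score_nickelateTriple`
  (closed form), `nickelateTriple_agree_iff` (AGREE iff LED by «1BH» or «UND:MULTIORB»), `nickelateTriple_bh1_riders_immaterial`,
  `nickelateTriple_ne_agree_of_other_head` (the PARTIAL ceiling behind every pre-named at-risk shape of block63: Ni-site straddle,
  «3BE»-led, «UND:HF», «EPH», «CI» leading); and the two earlier triples RE-DERIVED from §1 in one line each
  (`score_latticeTriple_eq_pair'`, `score_tetradymiteTriple_eq_pair'`) — consistency with p797367 / p799276.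
* §3 instances by `decide`: `block63_table` (the sixteen desk-check prints of 06:57Z, lead g41 re-ran them IDENTICAL on
  `deed1d82518e3e2d`), `nickelate_precedents` (infinite-layer «1BH+3BE» rows 43–149 ⇒ AGREE; RP «UND:MULTIORB(k=2…)» M23 / M263 ⇒ AGREE;
  the La₄Ni₃O₁₀ M40 @0 inner-site straddle shape «UND:MIXED+UND:MULTIORB+…» ⇒ PARTIAL; the T′-trilayer flattened two-site print
  M330 / M331 «1BH+3BE+1BH+3BE» ⇒ AGREE).

WHAT THIS IS NOT: not a typing ruling (the curators' truth files and the lead's letters fix the alternatives), not the scorer of record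
(router_score.py / deputy-2 score.py are), and not a statement about nickelate physics; it says which prints CAN score AGREE under the
filed typing, so that «AGREE as registered and by theorem» is a mechanical sentence when the M125 word lands.
-/

namespace Summit.Ventures.CertifiedManyBodySolver.Downfold

namespace RouterScore

/-! ## §1 The sandwich triple, any head alphabet -/

section general

variable {α : Type*} [DecidableEq α] (structural : α → Bool)

omit [DecidableEq α] in
/-- the bare word «q» dominates every compound «q+secs» (same primary, its one token is among the compound's). [folklore] -/
theorem dominates_head_cons (q : α) (secs : List α) : Dominates [q] (q :: secs) :=
  ⟨rfl, fun t ht => by simp only [List.mem_singleton] at ht; subst ht; exact List.mem_cons_self⟩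

/-- THE SANDWICH TRIPLE ≡ THE PAIR: «q₁ ∣ q₁+secs ∣ w» scores every print like «q₁ ∣ w». [folklore] -/
theorem outcome_sandwich (e : List α) (q₁ : α) (secs w : List α) :
    outcome structural e [[q₁], q₁ :: secs, w] = outcome structural e [[q₁], w] := by
  have h1 : outcome structural e [[q₁], q₁ :: secs, w] = outcome structural e ([[q₁], w] ++ [q₁ :: secs]) :=
    outcome_alts_congr structural e (by
      intro a
      simp only [List.cons_append, List.nil_append, List.mem_cons, List.not_mem_nil, or_false]
      tauto)
  rw [h1]
  exact outcome_append_redundant structural e (alts := [[q₁], w]) (by simp) (dominates_head_cons q₁ secs)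

/-- … with a bare non-structural third word «q₂»: the two-singletons closed form (p797367 §1). [folklore] -/
theorem outcome_sandwich_singletons (p q₁ q₂ : α) (secs tl : List α) (h₁ : structural q₁ = false) (h₂ : structural q₂ = false) :
    outcome structural (p :: tl) [[q₁], q₁ :: secs, [q₂]] =
      (if structural p then .ABSTAIN_structure
       else if p = q₁ ∨ p = q₂ then .AGREE
       else if q₁ ∈ tl ∨ q₂ ∈ tl then .PARTIAL else .DISAGREE) := by
  rw [outcome_sandwich]
  exact outcome_two_singletons structural p q₁ q₂ tl h₁ h₂

/-- … hence AGREE iff LED by q₁ or q₂. [folklore] -/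
theorem sandwich_singletons_agree_iff (p q₁ q₂ : α) (secs tl : List α) (h₁ : structural q₁ = false) (h₂ : structural q₂ = false) :
    outcome structural (p :: tl) [[q₁], q₁ :: secs, [q₂]] = .AGREE ↔ p = q₁ ∨ p = q₂ := by
  rw [outcome_sandwich]
  exact two_singletons_agree_iff structural p q₁ q₂ tl h₁ h₂

end general

/-! ## §2 The T′-NICKELATE TRIPLE on the router's heads -/

open Head

/-- the typing of VSET v4 M125 Nd₆Ni₅O₁₂ (and of v8 M330 / M331): «1BH ∣ 1BH+UND:MULTIORB ∣ UND:MULTIORB». [folklore] -/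
def nickelateTriple : List (List Head) := [[bh1], [bh1, undMultiorb], [undMultiorb]]

/-- the two bare primaries it collapses to: «1BH ∣ UND:MULTIORB». [folklore] -/
def nickelatePair : List (List Head) := [[bh1], [undMultiorb]]

/-- THE NICKELATE TRIPLE ≡ THE PAIR on every print. [folklore] -/
theorem score_nickelateTriple_eq_pair (e : List Head) : score e nickelateTriple = score e nickelatePair :=
  outcome_sandwich Head.structural e bh1 [undMultiorb] [undMultiorb]

/-- THE NICKELATE TRIPLE IN CLOSED FORM: structural-led ⇒ ABSTAIN(structure); led by «1BH» or «UND:MULTIORB» ⇒ AGREE whatever rides;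
led by any other head ⇒ PARTIAL iff «1BH» or «UND:MULTIORB» rides, else DISAGREE. [folklore] -/
theorem score_nickelateTriple (p : Head) (tl : List Head) :
    score (p :: tl) nickelateTriple =
      (if p.structural then .ABSTAIN_structure
       else if p = bh1 ∨ p = undMultiorb then .AGREE
       else if bh1 ∈ tl ∨ undMultiorb ∈ tl then .PARTIAL else .DISAGREE) :=
  outcome_sandwich_singletons Head.structural p bh1 undMultiorb [undMultiorb] tl rfl rfl

/-- `AGREE` iff the print is LED by «1BH» or by «UND:MULTIORB». [folklore] -/
theorem nickelateTriple_agree_iff (p : Head) (tl : List Head) :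
    score (p :: tl) nickelateTriple = .AGREE ↔ p = bh1 ∨ p = undMultiorb :=
  sandwich_singletons_agree_iff Head.structural p bh1 undMultiorb [undMultiorb] tl rfl rfl

/-- riders are score-inert behind «1BH» («3BE», «CI», a k-head tag, even a structural token in rider position). [folklore] -/
theorem nickelateTriple_bh1_led (tl : List Head) : score (bh1 :: tl) nickelateTriple = .AGREE :=
  (nickelateTriple_agree_iff bh1 tl).2 (Or.inl rfl)

/-- … and behind «UND:MULTIORB» (the RP bilayer / trilayer k = 2 print). [folklore] -/
theorem nickelateTriple_multiorb_led (tl : List Head) : score (undMultiorb :: tl) nickelateTriple = .AGREE :=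
  (nickelateTriple_agree_iff undMultiorb tl).2 (Or.inr rfl)

/-- two «1BH»-led prints that differ only in their riders score the same. [folklore] -/
theorem nickelateTriple_bh1_riders_immaterial (r₁ r₂ : List Head) :
    score (bh1 :: r₁) nickelateTriple = score (bh1 :: r₂) nickelateTriple := by
  rw [nickelateTriple_bh1_led, nickelateTriple_bh1_led]

/-- a print led by neither typed head is never AGREE — the ceiling behind every pre-named at-risk shape of block63 (a Ni-site
straddle «UND:MIXED», «3BE» leading, an «UND:HF» D-line, «EPH», a leading «CI»). [folklore] -/
theorem nickelateTriple_ne_agree_of_other_head (p : Head) (tl : List Head) (h1 : p ≠ bh1) (h2 : p ≠ undMultiorb) :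
    score (p :: tl) nickelateTriple ≠ .AGREE := by
  rw [Ne, nickelateTriple_agree_iff]
  rintro (h | h)
  · exact h1 h
  · exact h2 h

/-- consistency: the LATTICE TRIPLE collapse of p797367 §2 is the sandwich lemma with w = «UND:LATTICE». [folklore] -/
theorem score_latticeTriple_eq_pair' (e : List Head) : score e latticeTriple = score e latticePair :=
  outcome_sandwich Head.structural e bh1 [undLattice] [undLattice]

/-- consistency: the TETRADYMITE TRIPLE collapse of p799276 §4 is the sandwich lemma with q₁ = «EPH», secs = [UND:STRUCT], w = «BI». [folklore] -/
theorem score_tetradymiteTriple_eq_pair' (e : List Head) : score e tetradymiteTriple = score e ephBiPair :=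
  outcome_sandwich Head.structural e eph [undStruct] [bi]

/-! ## §3 The instances: block63 (2026-08-31T06:57Z) and the nickelate precedents of record -/

/-- The block63 desk table by `decide` (VSET v4 M125 Nd₆Ni₅O₁₂ @0, registered at HELD stage before any letter / number; lead g41
re-ran it identical on router_score.py `deed1d82518e3e2d`): «1BH», «1BH+3BE», «1BH+CI», «1BH+UND:MULTIORB», «UND:MULTIORB»,
«UND:MULTIORB+1BH» ⇒ AGREE; the straddle / «3BE» / «UND:HF» / «CI» heads WITH a typed head riding ⇒ PARTIAL; «UND:MIXED», «3BE»,
«UND:HF», «EPH» rider-less ⇒ DISAGREE; a structure-LED print ⇒ ABSTAIN(structure). [folklore] -/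
theorem block63_table :
    score [bh1] nickelateTriple = .AGREE ∧ score [bh1, be3] nickelateTriple = .AGREE ∧
    score [bh1, ci] nickelateTriple = .AGREE ∧ score [bh1, undMultiorb] nickelateTriple = .AGREE ∧
    score [undMultiorb] nickelateTriple = .AGREE ∧ score [undMultiorb, bh1] nickelateTriple = .AGREE ∧
    score [undMixed, undMultiorb] nickelateTriple = .PARTIAL ∧ score [undMixed, bh1] nickelateTriple = .PARTIAL ∧
    score [be3, bh1] nickelateTriple = .PARTIAL ∧ score [undHF, bh1] nickelateTriple = .PARTIAL ∧
    score [ci, bh1] nickelateTriple = .PARTIAL ∧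
    score [undMixed] nickelateTriple = .DISAGREE ∧ score [be3] nickelateTriple = .DISAGREE ∧
    score [undHF] nickelateTriple = .DISAGREE ∧ score [eph] nickelateTriple = .DISAGREE ∧
    score [undStruct, bh1] nickelateTriple = .ABSTAIN_structure := by
  decide

/-- The nickelate precedents of record under this typing: the infinite-layer print «1BH+3BE» (WORDS rows 43 / 44 / 52 / 53 / 85 /
149 / 530: M21 NdNiO₂, M22 / M279 NdSrNiO₂, M39a-b, M59, M60) ⇒ AGREE; the RP bilayer print «UND:MULTIORB(k=2: x²−y², z²; J_H)»
(M23 La₃Ni₂O₇ rows 154–156 / 439, M263 La₂PrNi₂O₇ rows 545–547) ⇒ AGREE; the La₄Ni₃O₁₀ M40 @0 inner-site straddle shape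
«UND:MIXED(…)+UND:MULTIORB(…)+UND:MULTIORB(…)» (rows 67 / 157) ⇒ PARTIAL; the T′-trilayer flattened two-site print of M330 / M331
«1BH+3BE+1BH(@Ni_inner)+3BE(@Ni_inner)» (rows 555 / 556) ⇒ AGREE (= `v8late_trilayer_nickelate`.1 p595911). [folklore] -/
theorem nickelate_precedents :
    score [bh1, be3] nickelateTriple = .AGREE ∧
    score [undMultiorb] nickelateTriple = .AGREE ∧
    score [undMixed, undMultiorb, undMultiorb] nickelateTriple = .PARTIAL ∧
    score [bh1, be3, bh1, be3] nickelateTriple = .AGREE := by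
  decide

end RouterScore

end Summit.Ventures.CertifiedManyBodySolver.Downfold
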